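import Mathlib
import Summits.Ventures.HodgeRepro2.T5SchurTensor

/-!
# Equivariance of the second-factor map `t` in `Φ = 1 ⊗ t`

Blind cell `pub-hodge-repro2`, seat p8 (gen 5), Tier-5 kernel support.  `T5SchurTensor`
(p391579) shows that an `S`-linear map `Φ : M ⊗[k] A → M ⊗[k] B` with `End_S(M) = k` is of the
form `Φ(m ⊗ a) = m ⊗ t a` for a unique `k`-linear `t : A → B`.  The record
(route/T5-N3-route-2.md §N3.12.4 step (s3); TIER5.md block N3: «what stays prose: … the
(𝔤′,K′)-equivariance of `t` (inherited from `Φ̄`)») then uses, in prose, that `t` inherits the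
equivariance of `Φ` for any family of operators acting through the second factor.  This file
kernel-checks that inheritance: if `Φ` intertwines `1 ⊗ α` with `1 ⊗ β` then `t` intertwines `α`
with `β` — by injectivity of `b ↦ m₀ ⊗ b` for one `m₀ ≠ 0` (`T5SchurTensor.tmul_right_injective'`).
No linearity of `Φ` is needed for the inheritance itself; the packaged statement
`exists_linear_equivariant` combines it with `T5SchurTensor.exists_linear`.

In the record: `k = ℂ`, `M = ρ` (the irreducible admissible `(𝔤,K)`-module, `S` its acting
algebra), `A = ρ′_1`, `B = ρ′`, the family `α i`/`β i` = the operators of `(𝔤′, K′)` on `ρ′_1`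
and `ρ′`, `Φ = Φ̄` the map of (s3); `t` is then `(𝔤′,K′)`-equivariant.  The Schur hypothesis
`End_S(M) = k` is supplied by `T5DixmierSchur.exists_smul_eq` (p391867).

README §8(d): uses an L-value-free non-vanishing device: NO.
-/

namespace Summit.Ventures.HodgeRepro2.T5SchurTensorEquivariance

open TensorProduct
open Summit.Ventures.HodgeRepro2.T5SchurTensor

variable {k : Type*} [Field k] {M A B : Type*} [AddCommGroup M] [Module k M] [AddCommGroup A]
  [Module k A] [AddCommGroup B] [Module k B]

/-- **Inheritance of equivariance.** If `Φ (m ⊗ a) = m ⊗ t a` for all `m, a`, and `Φ`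
intertwines `1 ⊗ α` with `1 ⊗ β`, then `t` intertwines `α` with `β` (given one `m₀ ≠ 0`). -/
theorem map_comm_of_tmul_eq {m₀ : M} (hm₀ : m₀ ≠ 0) (Φ : M ⊗[k] A → M ⊗[k] B) (t : A → B)
    (ht : ∀ m a, Φ (m ⊗ₜ[k] a) = m ⊗ₜ[k] t a) (α : A →ₗ[k] A) (β : B →ₗ[k] B)
    (hΦ : ∀ x, Φ (TensorProduct.map LinearMap.id α x) = TensorProduct.map LinearMap.id β (Φ x))
    (a : A) : t (α a) = β (t a) := by
  refine tmul_right_injective' (k := k) hm₀ ?_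
  calc m₀ ⊗ₜ[k] t (α a) = Φ (m₀ ⊗ₜ[k] α a) := (ht m₀ (α a)).symm
    _ = Φ (TensorProduct.map LinearMap.id α (m₀ ⊗ₜ[k] a)) := by
        rw [TensorProduct.map_tmul, LinearMap.id_apply]
    _ = TensorProduct.map LinearMap.id β (Φ (m₀ ⊗ₜ[k] a)) := hΦ _
    _ = TensorProduct.map LinearMap.id β (m₀ ⊗ₜ[k] t a) := by rw [ht]
    _ = m₀ ⊗ₜ[k] β (t a) := by rw [TensorProduct.map_tmul, LinearMap.id_apply]

/-- The same for a whole family of operators `α i` on `A` and `β i` on `B`. -/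
theorem map_comm_of_tmul_eq_family {m₀ : M} (hm₀ : m₀ ≠ 0) (Φ : M ⊗[k] A → M ⊗[k] B)
    (t : A → B) (ht : ∀ m a, Φ (m ⊗ₜ[k] a) = m ⊗ₜ[k] t a) {ι : Type*} (α : ι → A →ₗ[k] A)
    (β : ι → B →ₗ[k] B)
    (hΦ : ∀ i x, Φ (TensorProduct.map LinearMap.id (α i) x) =
      TensorProduct.map LinearMap.id (β i) (Φ x)) (i : ι) (a : A) :
    t (α i a) = β i (t a) :=
  map_comm_of_tmul_eq hm₀ Φ t ht (α i) (β i) (hΦ i) a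

section Packaged

variable {S : Type*} [Ring S] [Algebra k S] [Module S M] [IsScalarTower k S M]

/-- **`Φ = 1 ⊗ t` with `t` equivariant.** Under Schur for `M` (`End_S(M) = k`), an `S`-linear
`Φ : M ⊗[k] A → M ⊗[k] B` intertwining `1 ⊗ α i` with `1 ⊗ β i` for a family of operators is
`1 ⊗ t` for a `k`-linear `t` intertwining `α i` with `β i`. -/
theorem exists_linear_equivariant [Nontrivial M]
    (hSchur : ∀ φ : M →ₗ[S] M, ∃ c : k, ∀ x, φ x = c • x)
    (Φ : M ⊗[k] A →ₗ[S] M ⊗[k] B) {ι : Type*} (α : ι → A →ₗ[k] A) (β : ι → B →ₗ[k] B)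
    (hΦ : ∀ i x, Φ (TensorProduct.map LinearMap.id (α i) x) =
      TensorProduct.map LinearMap.id (β i) (Φ x)) :
    ∃ t : A →ₗ[k] B, (∀ m a, Φ (m ⊗ₜ[k] a) = m ⊗ₜ[k] t a) ∧ ∀ i a, t (α i a) = β i (t a) := by
  obtain ⟨t, ht⟩ := exists_linear hSchur Φ
  obtain ⟨m₀, hm₀⟩ := exists_ne (0 : M)
  exact ⟨t, ht, map_comm_of_tmul_eq_family hm₀ (fun x => Φ x) t ht α β hΦ⟩

/-- Group form: for representations `ρA`, `ρB` of a group `G'` on `A`, `B` and an `S`-linear `Φ`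
commuting with `1 ⊗ ρA g` / `1 ⊗ ρB g` for every `g`, the map `t` is `G'`-equivariant. -/
theorem exists_linear_equivariant_of_representation [Nontrivial M] {G' : Type*} [Group G']
    (hSchur : ∀ φ : M →ₗ[S] M, ∃ c : k, ∀ x, φ x = c • x)
    (Φ : M ⊗[k] A →ₗ[S] M ⊗[k] B) (ρA : Representation k G' A) (ρB : Representation k G' B)
    (hΦ : ∀ g x, Φ (TensorProduct.map LinearMap.id (ρA g) x) =
      TensorProduct.map LinearMap.id (ρB g) (Φ x)) :
    ∃ t : A →ₗ[k] B, (∀ m a, Φ (m ⊗ₜ[k] a) = m ⊗ₜ[k] t a) ∧ ∀ g a, t (ρA g a) = ρB g (t a) :=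
  exists_linear_equivariant hSchur Φ (fun g => ρA g) (fun g => ρB g) hΦ

end Packaged

end Summit.Ventures.HodgeRepro2.T5SchurTensorEquivariance
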